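import Mathlib
import Literature.Probability.Percolation.SmoothedWhiteNoise
import Literature.Probability.Percolation.Crossings
import Literature.Probability.Percolation.PlanarDuality
import Literature.Probability.Percolation.KSTPeriodicDefs
import Literature.Probability.Percolation.KSTPeriodicStatements
import Literature.Probability.Percolation.KSTPeriodicSymmetry
import Literature.Probability.Percolation.KSTPeriodicWeak
import Literature.Probability.Percolation.KSTPeriodicBridgesGlue
import Literature.Probability.Percolation.KSTPeriodicDualMeasure
import Literature.Probability.Percolation.KSTPeriodicDualTransfer
import Summits.CriticalPhenomena.CardyFormulaZ2.Theorems.CardyWhiteToColouredNoiseDiscretisationSignMeasurable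
import Summits.CriticalPhenomena.CardyFormulaZ2.Theorems.CardySelfRefinementCriticalPathRSWStubRswOfCertificates3DualA

/-!
# Stub stub_shortWayHalf — the short way is crossed with probability at least `1/2` (line `birth` of crux `DriftBound`)

Helper file for crux item `DriftBound` (stmt-CriticalPhenomena-4596) of route `CardyWhiteToColoured`
(`CardyFormulaZ2`), stub S4b of the registered line `Cruxes/DriftBound/Lines/birth.lean` (v3).

For the law `μ = signConfigLaw σ 1` (`σ > 0`) of the sign configuration of the Gaussian-smoothed
lattice white noise, assuming its lattice symmetries (S12: translations, transposition, reflection)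
and its exact self-duality (S4a: `μ.map dualConfig = μ`), the short-way crossing `𝓒₀(N, 8N)` of
`R₀(N, 8N) = [−N, N] × [−8N, 8N]` has probability `≥ 1/2` for every `N ≥ 1`. Pure planar-crossing
bookkeeping:

* `μ` is a probability measure carried by lattice configurations (`signConfig ⊆ E(ℤ²)`);
* planar duality (`lrCrossing_xor_dualTBCrossing_holds`): `μ(LR[0,m]×[0,n]) + μ(TB*) = 1`;
* by self-duality, `openCrossing_comm` and the transposition the dual term is the primal crossing
  probability `μ(lrRect (−1) n 0 (m − 1))`, so with `m = n + 1` and a unit translation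
  `μ(lrRect 0 (n + 1) 0 n) = 1/2` exactly;
* `𝓒₀(N, 8N) = lrRect (−N) N (−8N) (8N) ⊇ lrRect (−N) N 0 (2N − 1)` (narrower-and-taller
  monotonicity `lrRect_subset_lrRect`), a translate of `lrRect 0 (2N) 0 (2N − 1)`, whence `≥ 1/2`.

The identifications `LR(m, n) = lrRect 0 m 0 n` and `TB*(m, n) = dualConfig ⁻¹' tbRect 0 (m−1) (−1) n`
are the tree's `RswCertDual.lrCrossing_eq_lrRect` / `RswCertDual.dualTBCrossing_eq_preimage_tbRect`.

References: G. Grimmett, *Percolation* (1999), §11.2, Lemma 11.21; B. Bollobás, O. Riordan,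
*Percolation* (2006), Ch. 3, Lemma 1 and Cor. 3; L. Köhler-Schindler, V. Tassion, Duke Math. J. 172
(2023), §1.
-/

noncomputable section

namespace Summit.CriticalPhenomena.CardyFormulaZ2.Cruxes.DriftBound.Birth

open Set Filter Topology MeasureTheory
open Literature.Probability.LatticeModels Literature.Probability.Percolation
open Summit.CriticalPhenomena.CardyFormulaZ2.Cruxes.CriticalPathRSW.FiniteSizeEnvelope

/-! ### The sign law is a lattice-carried probability measure -/

/-- `signConfigLaw σ δ` is a probability measure (image of the white noise under the measurable
sign map, `WhiteToColoured.measurable_signConfig`). -/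
theorem sw_isProbabilityMeasure_signConfigLaw (σ δ : ℝ) : IsProbabilityMeasure (signConfigLaw σ δ) :=
  Measure.isProbabilityMeasure_map
    (Summit.CriticalPhenomena.CardyFormulaZ2.Theorems.WhiteToColoured.measurable_signConfig σ δ).aemeasurable

/-- The sign law is carried by lattice configurations (`signConfig ⊆ E(ℤ²)` always). -/
theorem sw_latticeCarried_signConfigLaw (σ δ : ℝ) : KSTPeriodic.LatticeCarried (signConfigLaw σ δ) := by
  have hmeas : MeasurableSet {ω : BondConfig (Site 2) | ω ⊆ (zdGraph 2).edgeSet} := by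
    have h : {ω : BondConfig (Site 2) | ω ⊆ (zdGraph 2).edgeSet} =
        ⋂ e ∈ ((zdGraph 2).edgeSet)ᶜ, {ω | e ∉ ω} := by
      ext ω
      simp only [Set.mem_setOf_eq, Set.mem_iInter, Set.mem_compl_iff]
      exact ⟨fun h e he heω => he (h heω), fun h e heω => by_contra fun he => h e he heω⟩
    rw [h]
    exact MeasurableSet.biInter (Set.to_countable _) fun e _ => (measurableSet_mem e).compl
  exact (ae_map_iff
    (Summit.CriticalPhenomena.CardyFormulaZ2.Theorems.WhiteToColoured.measurable_signConfig σ δ).aemeasurable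
    hmeas).2 (Filter.Eventually.of_forall fun ξ => signConfig_subset_edgeSet σ δ ξ)

/-! ### Transport of rectangle crossings under translations and the transposition -/

section Transport

variable {μ : Measure (BondConfig (Site 2))}

/-- Translating a rectangle by `(p, q) ∈ ℤ²` does not change its left–right crossing probability
under a translation invariant measure. -/
theorem sw_real_lrRect_shift' (hsh : ∀ v : Site 2, μ.map (KST2023.act (Site.shift v)) = μ)
    (a b c d p q : ℤ) :
    μ.real (KSTPeriodic.lrRect (a + p) (b + p) (c + q) (d + q)) = μ.real (KSTPeriodic.lrRect a b c d) := by
  have h := KSTPeriodic.real_openCrossing_image (hsh ![p, q]) (KSTPeriodic.rect a b c d)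
    {x | x ∈ KSTPeriodic.rect a b c d ∧ x 0 = a} {x | x ∈ KSTPeriodic.rect a b c d ∧ x 0 = b}
  rw [KSTPeriodic.image_shift_rect, KSTPeriodic.image_shift_rect_col,
    KSTPeriodic.image_shift_rect_col] at h
  simpa [KSTPeriodic.lrRect] using h

/-- Translation invariance of left–right crossing probabilities, equational form: if
`a' − a = b' − b` and `c' − c = d' − d` then `[a', b'] × [c', d']` is a translate of
`[a, b] × [c, d]`. -/
theorem sw_real_lrRect_shift (hsh : ∀ v : Site 2, μ.map (KST2023.act (Site.shift v)) = μ)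
    {a b c d a' b' c' d' : ℤ} (h0 : a' - a = b' - b) (h1 : c' - c = d' - d) :
    μ.real (KSTPeriodic.lrRect a' b' c' d') = μ.real (KSTPeriodic.lrRect a b c d) := by
  have h := sw_real_lrRect_shift' hsh a b c d (a' - a) (c' - c)
  rwa [show a + (a' - a) = a' by ring, show b + (a' - a) = b' by linarith,
    show c + (c' - c) = c' by ring, show d + (c' - c) = d' by linarith] at h

/-- Vertical crossings of a rectangle are horizontal crossings of the transposed rectangle, for a
transposition invariant measure. -/
theorem sw_real_tbRect_eq_real_lrRect (htr : μ.map (KST2023.act KSTPeriodic.transposeEquiv) = μ)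
    (a b c d : ℤ) :
    μ.real (KSTPeriodic.tbRect a b c d) = μ.real (KSTPeriodic.lrRect c d a b) := by
  have h := KSTPeriodic.real_openCrossing_image htr (KSTPeriodic.rect a b c d)
    {x | x ∈ KSTPeriodic.rect a b c d ∧ x 1 = c} {x | x ∈ KSTPeriodic.rect a b c d ∧ x 1 = d}
  rw [KSTPeriodic.image_transpose_rect, KSTPeriodic.image_transpose_rect_row,
    KSTPeriodic.image_transpose_rect_row] at h
  simpa [KSTPeriodic.tbRect, KSTPeriodic.lrRect] using h.symm

end Transport

/-! ### Duality for a self-dual, symmetric, lattice-carried law -/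

section Duality

variable {μ : Measure (BondConfig (Site 2))}

/-- `μ(LR(m, n)) + μ(TB*(m, n)) = 1` for a probability measure carried by lattice configurations:
exactly one of the two events occurs (`lrCrossing_xor_dualTBCrossing_holds`). -/
theorem sw_real_lrCrossing_add_real_dualTBCrossing [IsProbabilityMeasure μ]
    (hL : KSTPeriodic.LatticeCarried μ) (m n : ℕ) :
    μ.real (lrCrossing m n) + μ.real (dualTBCrossing m n) = 1 := by
  have hunion : μ.real (lrCrossing m n ∪ dualTBCrossing m n) = 1 := by
    rw [← probReal_univ (μ := μ)]
    refine measureReal_congr (ae_eq_univ.2 ?_)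
    rw [measure_eq_zero_iff_ae_notMem]
    filter_upwards [hL] with ω hω hn
    rcases lrCrossing_xor_dualTBCrossing_holds m n hω with h | h
    · exact hn (Or.inl h.1)
    · exact hn (Or.inr h.1)
  have hinter : μ.real (lrCrossing m n ∩ dualTBCrossing m n) = 0 := by
    rw [measureReal_def, measure_eq_zero_iff_ae_notMem.2, ENNReal.toReal_zero]
    filter_upwards [hL] with ω hω hn
    rcases lrCrossing_xor_dualTBCrossing_holds m n hω with h | h
    · exact h.2 hn.2
    · exact h.2 hn.1
  have := measureReal_union_add_inter (μ := μ) (s := lrCrossing m n) (measurableSet_dualTBCrossing m n)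
  rw [hunion, hinter, add_zero] at this
  exact this.symm

/-- For a self-dual, transposition invariant law the dual crossing `TB*(m, n)` has the probability
of the primal left–right crossing of `[−1, n] × [0, m − 1]`. -/
theorem sw_real_dualTBCrossing (hdual : μ.map dualConfig = μ)
    (htr : μ.map (KST2023.act KSTPeriodic.transposeEquiv) = μ) (m n : ℕ) :
    μ.real (dualTBCrossing m n) = μ.real (KSTPeriodic.lrRect (-1) n 0 ((m : ℤ) - 1)) := by
  rw [RswCertDual.dualTBCrossing_eq_preimage_tbRect,
    ← KSTPeriodic.real_map_dualConfig μ (KSTPeriodic.measurableSet_tbRect _ _ _ _), hdual,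
    sw_real_tbRect_eq_real_lrRect htr]

/-- **Self-duality of the `(n+1) × n` rectangle**: for a self-dual, translation and transposition
invariant probability measure carried by lattice configurations,
`μ(LR([0, n + 1] × [0, n])) = 1/2`. -/
theorem sw_real_lrRect_succ_self [IsProbabilityMeasure μ] (hL : KSTPeriodic.LatticeCarried μ)
    (hsh : ∀ v : Site 2, μ.map (KST2023.act (Site.shift v)) = μ)
    (htr : μ.map (KST2023.act KSTPeriodic.transposeEquiv) = μ) (hdual : μ.map dualConfig = μ)
    (n : ℕ) :
    μ.real (KSTPeriodic.lrRect 0 ((n : ℤ) + 1) 0 n) = 1 / 2 := by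
  have h1 := sw_real_lrCrossing_add_real_dualTBCrossing hL (n + 1) n
  rw [RswCertDual.lrCrossing_eq_lrRect, sw_real_dualTBCrossing hdual htr] at h1
  have h2 : μ.real (KSTPeriodic.lrRect (-1) (n : ℤ) 0 (((n + 1 : ℕ) : ℤ) - 1)) =
      μ.real (KSTPeriodic.lrRect 0 ((n + 1 : ℕ) : ℤ) 0 n) :=
    sw_real_lrRect_shift hsh (by push_cast; ring) (by push_cast; ring)
  rw [h2] at h1
  push_cast at h1
  linarith

end Duality

/-! ### The stub -/

/-- **Stub S4b — the short way is crossed with probability at least `1/2`.** Given the lattice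
symmetries (S12) and the exact self-duality (S4a) of the sign laws `signConfigLaw σ 1`, for every
`σ > 0` and `N ≥ 1` the horizontal crossing `𝓒₀(N, 8N)` of `R₀(N, 8N) = [−N, N] × [−8N, 8N]`
(the SHORT way) has `signConfigLaw σ 1`-probability `≥ 1/2`: the `2N × (2N − 1)` rectangle
`[−N, N] × [0, 2N − 1]` is crossed horizontally with probability exactly `1/2`
(`sw_real_lrRect_succ_self` and a translation), and such a crossing is a crossing of the taller
rectangle `R₀(N, 8N)` of the same width. -/
theorem stub_shortWayHalf :
    (∀ σ : ℝ, 0 < σ →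
      (∀ v : Literature.Probability.LatticeModels.Site 2,
        (Literature.Probability.Percolation.signConfigLaw σ 1).map
            (Literature.Probability.Percolation.KST2023.act
              (Literature.Probability.LatticeModels.Site.shift v)) =
          Literature.Probability.Percolation.signConfigLaw σ 1) ∧
      (Literature.Probability.Percolation.signConfigLaw σ 1).map
          (Literature.Probability.Percolation.KST2023.act
            Literature.Probability.Percolation.KSTPeriodic.transposeEquiv) =
        Literature.Probability.Percolation.signConfigLaw σ 1 ∧
      (Literature.Probability.Percolation.signConfigLaw σ 1).map
          (Literature.Probability.Percolation.KST2023.act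
            (Literature.Probability.Percolation.KSTPeriodic.flipEquiv 0)) =
        Literature.Probability.Percolation.signConfigLaw σ 1) →
    (∀ σ : ℝ, 0 < σ →
      (Literature.Probability.Percolation.signConfigLaw σ 1).map
          Literature.Probability.Percolation.dualConfig =
        Literature.Probability.Percolation.signConfigLaw σ 1) →
    ∀ σ : ℝ, 0 < σ → ∀ N : ℕ, 1 ≤ N →
      (1 / 2 : ℝ) ≤ (Literature.Probability.Percolation.signConfigLaw σ 1).real
        (Literature.Probability.Percolation.KSTPeriodic.crossing 0 N (8 * N)) := by
  intro h12 h4a σ hσ N hN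
  obtain ⟨hsh, htr, -⟩ := h12 σ hσ
  have hdual := h4a σ hσ
  haveI : IsProbabilityMeasure (signConfigLaw σ 1) := sw_isProbabilityMeasure_signConfigLaw σ 1
  have hL : KSTPeriodic.LatticeCarried (signConfigLaw σ 1) := sw_latticeCarried_signConfigLaw σ 1
  -- the `2N × (2N - 1)` rectangle `[0, 2N] × [0, 2N - 1]` is crossed with probability `1/2`
  have hsq := sw_real_lrRect_succ_self hL hsh htr hdual (2 * N - 1)
  have hcast : (((2 * N - 1 : ℕ) : ℤ) : ℤ) = 2 * N - 1 := by omega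
  rw [hcast] at hsq
  -- translate it to `[-N, N] × [0, 2N - 1]`
  have hshift : (signConfigLaw σ 1).real (KSTPeriodic.lrRect (-(N : ℤ)) N 0 (2 * N - 1)) =
      (signConfigLaw σ 1).real (KSTPeriodic.lrRect 0 (2 * (N : ℤ) - 1 + 1) 0 (2 * N - 1)) :=
    sw_real_lrRect_shift hsh (by ring) (by ring)
  -- a crossing of it crosses the taller `R₀(N, 8N) = [-N, N] × [-8N, 8N]`
  have hmono : (signConfigLaw σ 1).real (KSTPeriodic.lrRect (-(N : ℤ)) N 0 (2 * N - 1)) ≤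
      (signConfigLaw σ 1).real (KSTPeriodic.crossing 0 N (8 * N)) := by
    unfold KSTPeriodic.crossing
    exact KSTPeriodic.real_lrRect_mono hL (by omega) (by omega) (by omega) (by omega) (by omega)
  linarith

end Summit.CriticalPhenomena.CardyFormulaZ2.Cruxes.DriftBound.Birth

end
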